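import Literature.Geometry.Lorentzian.BackgroundChartCalculusLocal
import Literature.Geometry.Lorentzian.DeviationTolerance
import HarnessLib

/-!
# Crux `ClusterCompleteness.OmegaLimitMultiKerr` (stmt-FinalStateConjecture-14664), line `Sketch` —
# consequences of the uniform `C⁰` anchor clause

Support lemmas (structure stub `norm_deviationExtend_le_of_anchor`, lead gen 3) for the crux
`OmegaLimitMultiKerr`, whose recur interface `Recurs k`
(`ClusterCompletenessOmegaLimitMultiKerrDefs`) carries the refuter-repaired uniform `C⁰` ANCHOR
(repair F2): at every chart time `τ > τ₀`,
`deviationCk (Minkowski.backgroundOn U₀) Ψ₀ 0 τ ≤ 1/4` for the flat chart `Ψ₀ : U₀ → 𝒟` and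
`truncDeviationCk (boostedKerrBackground …) (Ψ i) 0 (R i τ) τ ≤ 1/4` for every hole chart. This file
makes the pointwise content of that clause importable, over the tree's chart calculus
(`BackgroundChartCalculus(.Local)`, `DeviationTolerance`, `MultiCentreKerrSchild`):

* `norm_deviationExtend_le_of_anchor` (MAIN, closed form) — POINTWISE PINCHING of the flat chart:
  `‖(Ψ₀^* g − η)(x)‖ ≤ 1/4` at every late point `x ∈ U₀`, `x⁰ > τ₀` (the `m = 0` term of the `C⁰`
  sup norm on the slab `{y⁰ = x⁰}` through `x`, `Spacetime.norm_deviation_le_of_deviationCk_le`);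
  `norm_deviation_le_of_anchor` is the same bound for `Spacetime.deviation`;
* `norm_deviationExtend_le_of_truncAnchor` — the hole-chart analogue, for a general background `B`:
  the truncated anchor `truncDeviationCk B Ψ 0 (R τ) τ ≤ 1/4` (`τ > τ₀`) pinches `Ψ^* g − g_B` at
  every late point `x` of the certified near zone `r(x) ≤ R(t(x))`;
* `val_mfderiv_basisVector_zero_le_norm_deviation_sub_one` — for ANY chart map on a flat
  background, `g(dΨ₀ ∂₀, dΨ₀ ∂₀) ≤ ‖(Ψ₀^* g − η)(x)‖ − 1`; hence under the anchor
  `g(dΨ₀ ∂₀, dΨ₀ ∂₀) ≤ −3/4` and `dΨ₀ ∂₀` is TIMELIKE at every late point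
  (`val_mfderiv_basisVector_zero_le_of_anchor`, `isTimelike_mfderiv_basisVector_zero_of_anchor`):
  the chart time of an anchored chart is an honest clock (no "lagging clock" slabs);
* for a SMOOTH anchored flat chart (`IsLateChart.contMDiff`): `Ψ₀` is a local diffeomorphism at
  every late point and on the late region `{x⁰ > τ₀}` (`isLocalDiffeomorphAt_of_anchor`,
  `isLocalDiffeomorphOn_lateRegion_of_anchor`; inverse function theorem for the pinched
  parametrisation, O'Neill 1983, Ch. 5, Lemma 5.26, through
  `Spacetime.isLocalDiffeomorphAt_of_norm_deviationExtend_lt_one_of_contMDiffOn`), and the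
  time-orientation of `dΨ₀ ∂₀` is decided at ONE point of any preconnected late subset of `U₀`, in
  particular of the whole late half-space when `{x⁰ > τ₀} ⊆ U₀` (the `N = 0` column of the crux)
  (`isFutureDirected_mfderiv_basisVector_zero_of_anchor`, `…_of_anchor_of_subset`).

Everything is proved; Mathlib + `Literature` only, no definitions.
-/

-- every `Summit.FinalStateConjecture.FinalStateConjecture.…` name repeats the summit = sub-problem segment (D-0017 layout)
set_option linter.dupNamespace false

noncomputable section

open scoped Manifold ContDiff Topology ENNReal
open Set Filter TopologicalSpace

namespace Summit.FinalStateConjecture.FinalStateConjecture.Theorems.ClusterCompleteness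

open Literature.Geometry.Lorentzian

/-! ### Pointwise pinching from the anchor clause -/

/-- **The `C⁰` anchor pinches the flat chart pointwise** (registered structure stub of line
`Sketch`, crux stmt-FinalStateConjecture-14664). If
`deviationCk (Minkowski.backgroundOn U₀) Ψ₀ 0 τ ≤ 1/4` for every chart time `τ > τ₀` (the flat half
of the crux's anchor clause), then at every late point `x ∈ U₀`, `x⁰ > τ₀`, the operator norm of
the deviation `(Ψ₀^* g − η)(x) : E4 →L[ℝ] E4 →L[ℝ] ℝ` is at most `1/4`: `x` lies on the slab
`{y⁰ = x⁰}`, and `‖(Ψ₀^* g − η)(x)‖` is the `m = 0` term of the `C⁰` sup norm there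
(`Spacetime.norm_deviation_le_of_deviationCk_le`). Stated for the zero-extended deviation
`deviationExtend`, the form consumed by the chart calculus of `BackgroundChartCalculus(.Local)`.
[folklore] -/
theorem norm_deviationExtend_le_of_anchor :
    ∀ (𝓢 : Spacetime 4) (U₀ : Opens E4) (Ψ₀ : U₀ → 𝓢.carrier) (τ₀ : ℝ),
      (∀ τ : ℝ, τ₀ < τ →
        𝓢.deviationCk (Minkowski.backgroundOn U₀) Ψ₀ 0 τ ≤ ENNReal.ofReal (1 / 4)) →
      ∀ x : U₀, τ₀ < x.1 0 → ‖𝓢.deviationExtend (Minkowski.backgroundOn U₀) Ψ₀ x‖ ≤ 1 / 4 := by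
  intro 𝓢 U₀ Ψ₀ τ₀ h x hx
  -- `x` lies on the slab `{y⁰ = x⁰}` of the flat background (`B.time y = y 0` definitionally)
  have key := 𝓢.norm_deviation_le_of_deviationCk_le (Minkowski.backgroundOn U₀) Ψ₀ 0
    (by norm_num : (0 : ℝ) ≤ 1 / 4) (h (x.1 0) hx) (x := x) rfl
  rw [← Spacetime.deviationExtend_coe] at key
  exact key

/-- The same pinching for the honest deviation `Spacetime.deviation` at the late point (the form
consumed by cone estimates, e.g. `val_mfderiv_basisVector_zero_le_of_anchor`). [folklore] -/
theorem norm_deviation_le_of_anchor {𝓢 : Spacetime 4} {U₀ : Opens E4} {Ψ₀ : U₀ → 𝓢.carrier}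
    {τ₀ : ℝ} (h : ∀ τ : ℝ, τ₀ < τ →
      𝓢.deviationCk (Minkowski.backgroundOn U₀) Ψ₀ 0 τ ≤ ENNReal.ofReal (1 / 4))
    (x : U₀) (hx : τ₀ < x.1 0) : ‖𝓢.deviation (Minkowski.backgroundOn U₀) Ψ₀ x‖ ≤ 1 / 4 :=
  𝓢.norm_deviation_le_of_deviationCk_le (Minkowski.backgroundOn U₀) Ψ₀ 0
    (by norm_num : (0 : ℝ) ≤ 1 / 4) (h (x.1 0) hx) (x := x) rfl

/-- **The truncated anchor pinches a hole chart pointwise on the certified near zone.** For a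
general background `B` (e.g. `boostedKerrBackground Λ c M a`) and exhaustion radii `R`: if
`truncDeviationCk B Ψ 0 (R τ) τ ≤ 1/4` for every `τ > τ₀` (the hole half of the crux's anchor
clause), then `‖(Ψ^* g − g_B)(x)‖ ≤ 1/4` at every point `x` of the domain with `t(x) > τ₀` and
`r(x) ≤ R(t(x))`: `x` lies on the truncated slab `{t = t(x), r ≤ R(t(x))}`, and the norm is the
`m = 0` term of the `C⁰` sup norm there (`enorm_iteratedFDeriv_le_supCkENorm`,
`norm_iteratedFDeriv_zero`). [folklore] -/
theorem norm_deviationExtend_le_of_truncAnchor {𝓢 : Spacetime 4} {B : ModelBackground}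
    {Ψ : B.domain → 𝓢.carrier} {R : ℝ → ℝ} {τ₀ : ℝ}
    (h : ∀ τ : ℝ, τ₀ < τ → 𝓢.truncDeviationCk B Ψ 0 (R τ) τ ≤ ENNReal.ofReal (1 / 4))
    (x : B.domain) (hx : τ₀ < B.time x.1) (hR : B.radius x.1 ≤ R (B.time x.1)) :
    ‖𝓢.deviationExtend B Ψ x‖ ≤ 1 / 4 := by
  have hmem : x ∈ B.truncTimeSlab (R (B.time x.1)) (B.time x.1) := ⟨rfl, hR⟩
  have hτ : supCkENorm (Subtype.val '' B.truncTimeSlab (R (B.time x.1)) (B.time x.1)) 0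
      (𝓢.deviationExtend B Ψ) ≤ ENNReal.ofReal (1 / 4) := h _ hx
  have h' := (enorm_iteratedFDeriv_le_supCkENorm (le_refl 0) (mem_image_of_mem Subtype.val hmem)
    (𝓢.deviationExtend B Ψ)).trans hτ
  rwa [← ofReal_norm, ENNReal.ofReal_le_ofReal_iff (by norm_num), norm_iteratedFDeriv_zero] at h'

/-! ### The chart time of an anchored flat chart is timelike -/

/-- **`g(dΨ₀ ∂₀, dΨ₀ ∂₀) ≤ ‖(Ψ₀^* g − η)(x)‖ − 1`** for ANY chart map `Ψ₀ : U₀ → 𝓢` on a flat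
background and any point `x`: `g(dΨ₀ ∂₀, dΨ₀ ∂₀) = η(∂₀, ∂₀) + (Ψ₀^* g − η)(∂₀, ∂₀)` with
`η(∂₀, ∂₀) = −1` and `|(Ψ₀^* g − η)(∂₀, ∂₀)| ≤ ‖Ψ₀^* g − η‖ ‖∂₀‖² = ‖Ψ₀^* g − η‖` (operator norm on
`E4`). O'Neill 1983, Ch. 5, Lemma 5.26 (perturbative form, cf.
`Minkowski.apply_basisVector_zero_neg_of_norm_sub_bilin_lt_one`).
[cite: ONeill1983, Ch. 5, Lemma 5.26] -/
theorem val_mfderiv_basisVector_zero_le_norm_deviation_sub_one {𝓢 : Spacetime 4} {U₀ : Opens E4}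
    (Ψ₀ : U₀ → 𝓢.carrier) (x : U₀) :
    𝓢.metric.val (Ψ₀ x) (mfderiv 𝓘(ℝ, E4) (𝓡 4) Ψ₀ x (E4.basisVector 0))
        (mfderiv 𝓘(ℝ, E4) (𝓡 4) Ψ₀ x (E4.basisVector 0)) ≤
      ‖𝓢.deviation (Minkowski.backgroundOn U₀) Ψ₀ x‖ - 1 := by
  -- the unfolding lemma `deviation_apply`, elaborated against the present statement of the terms
  -- (`x : ↥U₀` rather than `x : (Minkowski.backgroundOn U₀).domain`)
  have h1 : 𝓢.deviation (Minkowski.backgroundOn U₀) Ψ₀ x (E4.basisVector 0) (E4.basisVector 0) =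
      𝓢.metric.val (Ψ₀ x) (mfderiv 𝓘(ℝ, E4) (𝓡 4) Ψ₀ x (E4.basisVector 0))
          (mfderiv 𝓘(ℝ, E4) (𝓡 4) Ψ₀ x (E4.basisVector 0)) -
        Minkowski.bilin (E4.basisVector 0) (E4.basisVector 0) :=
    𝓢.deviation_apply (Minkowski.backgroundOn U₀) Ψ₀ x (E4.basisVector 0) (E4.basisVector 0)
  have hn : ‖(E4.basisVector 0 : E4)‖ = 1 := by simp [E4.basisVector]
  have h3 := ContinuousLinearMap.le_opNorm₂ (𝓢.deviation (Minkowski.backgroundOn U₀) Ψ₀ x)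
    (E4.basisVector 0) (E4.basisVector 0)
  rw [hn, mul_one, mul_one, Real.norm_eq_abs, h1, Minkowski.bilin_basisVector_zero] at h3
  linarith [(abs_le.mp h3).2]

/-- **Under the anchor, `g(dΨ₀ ∂₀, dΨ₀ ∂₀) ≤ −3/4` at every late point** of the flat chart
(`−1 + 1/4`; no smoothness hypothesis: `mfderiv` of a non-differentiable map is `0`, for which the
deviation would be `−η`, of norm `1 > 1/4`). [cite: ONeill1983, Ch. 5, Lemma 5.26] -/
theorem val_mfderiv_basisVector_zero_le_of_anchor {𝓢 : Spacetime 4} {U₀ : Opens E4}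
    {Ψ₀ : U₀ → 𝓢.carrier} {τ₀ : ℝ} (h : ∀ τ : ℝ, τ₀ < τ →
      𝓢.deviationCk (Minkowski.backgroundOn U₀) Ψ₀ 0 τ ≤ ENNReal.ofReal (1 / 4))
    (x : U₀) (hx : τ₀ < x.1 0) :
    𝓢.metric.val (Ψ₀ x) (mfderiv 𝓘(ℝ, E4) (𝓡 4) Ψ₀ x (E4.basisVector 0))
        (mfderiv 𝓘(ℝ, E4) (𝓡 4) Ψ₀ x (E4.basisVector 0)) ≤ -(3 / 4) := by
  have h1 := val_mfderiv_basisVector_zero_le_norm_deviation_sub_one Ψ₀ x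
  have h2 := norm_deviation_le_of_anchor h x hx
  linarith

/-- **The chart time of an anchored flat chart is timelike**: `dΨ₀(∂₀)` is a timelike vector of
`(𝓢, g)` at every late point `x ∈ U₀`, `x⁰ > τ₀` (so the coordinate slabs `{x⁰ = τ}` are met
transversally by the timelike direction `dΨ₀ ∂₀`; the consequence the refuters' repair F2 was
designed to buy). [cite: ONeill1983, Ch. 5, Lemma 5.26] -/
theorem isTimelike_mfderiv_basisVector_zero_of_anchor {𝓢 : Spacetime 4} {U₀ : Opens E4}
    {Ψ₀ : U₀ → 𝓢.carrier} {τ₀ : ℝ} (h : ∀ τ : ℝ, τ₀ < τ →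
      𝓢.deviationCk (Minkowski.backgroundOn U₀) Ψ₀ 0 τ ≤ ENNReal.ofReal (1 / 4))
    (x : U₀) (hx : τ₀ < x.1 0) :
    𝓢.metric.IsTimelike (mfderiv 𝓘(ℝ, E4) (𝓡 4) Ψ₀ x (E4.basisVector 0)) :=
  lt_of_le_of_lt (val_mfderiv_basisVector_zero_le_of_anchor h x hx) (by norm_num)

/-! ### A smooth anchored flat chart is a local diffeomorphism on the late region -/

/-- The late part `{y⁰ > τ₀} ∩ U₀` of the flat domain is open in `E4`. [folklore] -/
private theorem isOpen_setOf_lt_apply_zero_inter {U₀ : Opens E4} (τ₀ : ℝ) :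
    IsOpen ({y : E4 | τ₀ < y 0} ∩ (U₀ : Set E4)) :=
  (isOpen_lt continuous_const (PiLp.continuous_apply 2 _ 0)).inter U₀.2

/-- **A smooth anchored flat chart is a local diffeomorphism at every late point.** If
`Ψ₀ : U₀ → 𝓢` is smooth (`IsLateChart.contMDiff`) and anchored after `τ₀`, then at every `x ∈ U₀`
with `x⁰ > τ₀` the pinching `‖(Ψ₀^* g − η)(x)‖ ≤ 1/4 < 1` makes the components of the
parametrisation nondegenerate, so `dΨ₀` is invertible and `Ψ₀` is a local diffeomorphism at `x`
(inverse function theorem;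
`Spacetime.isLocalDiffeomorphAt_of_norm_deviationExtend_lt_one_of_contMDiffOn` on the open piece
`W = {y⁰ > τ₀} ∩ U₀`). [cite: ONeill1983, Ch. 5, Lemma 5.26] -/
theorem isLocalDiffeomorphAt_of_anchor {𝓢 : Spacetime 4} {U₀ : Opens E4} {Ψ₀ : U₀ → 𝓢.carrier}
    {τ₀ : ℝ} (hΨ : ContMDiff 𝓘(ℝ, E4) (𝓡 4) ∞ Ψ₀) (h : ∀ τ : ℝ, τ₀ < τ →
      𝓢.deviationCk (Minkowski.backgroundOn U₀) Ψ₀ 0 τ ≤ ENNReal.ofReal (1 / 4))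
    (x : U₀) (hx : τ₀ < x.1 0) : IsLocalDiffeomorphAt 𝓘(ℝ, E4) (𝓡 4) ∞ Ψ₀ x :=
  𝓢.isLocalDiffeomorphAt_of_norm_deviationExtend_lt_one_of_contMDiffOn Ψ₀
    (W := {y : E4 | τ₀ < y 0} ∩ (U₀ : Set E4)) (isOpen_setOf_lt_apply_zero_inter τ₀)
    inter_subset_right hΨ.contMDiffOn x ⟨hx, x.2⟩
    ((norm_deviationExtend_le_of_anchor 𝓢 U₀ Ψ₀ τ₀ h x hx).trans_lt (by norm_num))

/-- **A smooth anchored flat chart is a local diffeomorphism on its late region**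
`(Minkowski.backgroundOn U₀).lateRegion τ₀ = {x ∈ U₀ | x⁰ > τ₀}` (pointwise from
`isLocalDiffeomorphAt_of_anchor`). [cite: ONeill1983, Ch. 5, Lemma 5.26] -/
theorem isLocalDiffeomorphOn_lateRegion_of_anchor {𝓢 : Spacetime 4} {U₀ : Opens E4}
    {Ψ₀ : U₀ → 𝓢.carrier} {τ₀ : ℝ} (hΨ : ContMDiff 𝓘(ℝ, E4) (𝓡 4) ∞ Ψ₀) (h : ∀ τ : ℝ, τ₀ < τ →
      𝓢.deviationCk (Minkowski.backgroundOn U₀) Ψ₀ 0 τ ≤ ENNReal.ofReal (1 / 4)) :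
    IsLocalDiffeomorphOn 𝓘(ℝ, E4) (𝓡 4) ∞ Ψ₀ ((Minkowski.backgroundOn U₀).lateRegion τ₀) :=
  fun x ↦ isLocalDiffeomorphAt_of_anchor hΨ h x.1 x.2

/-! ### Time-orientation of an anchored flat chart is decided at one point -/

/-- **Orientation on a preconnected late set from one point.** For a smooth flat chart `Ψ₀` anchored
after `τ₀` and a preconnected `S ⊆ U₀ ∩ {y⁰ > τ₀}`: if `dΨ₀(∂₀)` is future-directed at one point of
`S`, it is future-directed at every point of `S` (it is timelike on `S` by the anchor, and a
continuous timelike field over a preconnected set has one time-orientation;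
`Spacetime.isFutureDirected_mfderiv_basisVector_zero_of_isPreconnected_of_contMDiffOn`).
[cite: ONeill1983, Ch. 5, Lemma 5.26 ff., p. 145] -/
theorem isFutureDirected_mfderiv_basisVector_zero_of_anchor {𝓢 : Spacetime 4} {U₀ : Opens E4}
    {Ψ₀ : U₀ → 𝓢.carrier} {τ₀ : ℝ} (hΨ : ContMDiff 𝓘(ℝ, E4) (𝓡 4) ∞ Ψ₀) (h : ∀ τ : ℝ, τ₀ < τ →
      𝓢.deviationCk (Minkowski.backgroundOn U₀) Ψ₀ 0 τ ≤ ENNReal.ofReal (1 / 4))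
    {S : Set E4} (hS : IsPreconnected S) (hSU : S ⊆ (U₀ : Set E4)) (hSτ : ∀ y ∈ S, τ₀ < y 0)
    {z₁ : U₀} (hz₁ : (z₁ : E4) ∈ S)
    (h₁ : 𝓢.timeOrientation.IsFutureDirected (mfderiv 𝓘(ℝ, E4) (𝓡 4) Ψ₀ z₁ (E4.basisVector 0)))
    (z : U₀) (hz : (z : E4) ∈ S) :
    𝓢.timeOrientation.IsFutureDirected (mfderiv 𝓘(ℝ, E4) (𝓡 4) Ψ₀ z (E4.basisVector 0)) :=
  𝓢.isFutureDirected_mfderiv_basisVector_zero_of_isPreconnected_of_contMDiffOn Ψ₀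
    (W := {y : E4 | τ₀ < y 0} ∩ (U₀ : Set E4)) (isOpen_setOf_lt_apply_zero_inter τ₀)
    inter_subset_right hΨ.contMDiffOn
    (fun y hy ↦ (norm_deviationExtend_le_of_anchor 𝓢 U₀ Ψ₀ τ₀ h ⟨y, hy.2⟩ hy.1).trans_lt
      (by norm_num))
    hS (fun y hy ↦ ⟨hSτ y hy, hSU hy⟩) hz₁ h₁ z hz

/-- **The `N = 0` column: orientation on the whole late half-space from one point.** If the flat
domain contains the late half-space `{y⁰ > τ₀}` (clause 6 of `Recurs` with no hole), which is convex
hence preconnected, then a smooth anchored flat chart whose `dΨ₀(∂₀)` is future-directed at one late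
point has `dΨ₀(∂₀)` future-directed at every late point.
[cite: ONeill1983, Ch. 5, Lemma 5.26 ff., p. 145] -/
theorem isFutureDirected_mfderiv_basisVector_zero_of_anchor_of_subset {𝓢 : Spacetime 4}
    {U₀ : Opens E4} {Ψ₀ : U₀ → 𝓢.carrier} {τ₀ : ℝ} (hΨ : ContMDiff 𝓘(ℝ, E4) (𝓡 4) ∞ Ψ₀)
    (h : ∀ τ : ℝ, τ₀ < τ →
      𝓢.deviationCk (Minkowski.backgroundOn U₀) Ψ₀ 0 τ ≤ ENNReal.ofReal (1 / 4))
    (hU : {y : E4 | τ₀ < y 0} ⊆ (U₀ : Set E4)) {z₁ : U₀} (hz₁ : τ₀ < z₁.1 0)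
    (h₁ : 𝓢.timeOrientation.IsFutureDirected (mfderiv 𝓘(ℝ, E4) (𝓡 4) Ψ₀ z₁ (E4.basisVector 0)))
    (z : U₀) (hz : τ₀ < z.1 0) :
    𝓢.timeOrientation.IsFutureDirected (mfderiv 𝓘(ℝ, E4) (𝓡 4) Ψ₀ z (E4.basisVector 0)) :=
  isFutureDirected_mfderiv_basisVector_zero_of_anchor hΨ h
    (convex_halfSpace_gt (𝕜 := ℝ) (f := fun y : E4 ↦ y 0) ⟨fun _ _ ↦ rfl, fun _ _ ↦ rfl⟩
      τ₀).isPreconnected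
    hU (fun _ hy ↦ hy) hz₁ h₁ z hz

end Summit.FinalStateConjecture.FinalStateConjecture.Theorems.ClusterCompleteness

end
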